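/-
Origin: expansion seat `planner-pub-hodgecm-pv06-0`, handover v2 2026-08-18T03:57:07Z (`HOME/pub-hodgecm-pv06/lean/Pv06/PerL34/Vanishing.lean`, md5 867f8bdd, 303 lines);
landed by the gen-5 packager in gate run 20 as `HodgeCM/PerL34/Vanishing.lean` (verbatim).
-/
/-
Origin: pub-hodgecm formalisation cell (harness21, 2026), seat pub-hodgecm-pv06 (DAG-NODE PROVER #06),
supplement to node N23c (PerL v5 d912a121, Prop. 3.6 `prop:isol`, Step 2, tex ll. 423–426).
Proposed place: `HodgeCM/PerL34/Vanishing.lean` (module rename `Pv06.PerL34.Vanishing` ↦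
`HodgeCM.PerL34.Vanishing`; namespace `HodgeCM.PerL34.Vanishing`).  Imports: Mathlib only.

KIND: L1 (kernel lemma in Mathlib generality; no facts, no `Universe`, nothing posited, nothing cited).

WHAT.  PerL v5 ll. 423–426: "for f ∈ C_c^∞(U(W)(𝔸)) … 0 = ⟨E^χ_f, v⟩ = ∫_{U(W)(𝔸)} f(h) conj(P_{T,χ̄}(R(h)v)) dh
for all f, so the continuous function h ↦ P_{T,χ̄}(R(h)v) vanishes identically."  The displayed
IDENTITY is pv15's kernel theorem `HodgeCM.PerL34.N23a.unfolding_inner` (handed over 03:47Z); the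
INFERENCE "for all f ⇒ vanishes identically" is the fundamental lemma of the calculus of variations on a
locally compact space with a measure charging every nonempty open set (Haar measure does:
`IsHaarMeasure.toIsOpenPosMeasure`).  This file KERNEL-PROVES that inference:

* `eq_zero_of_forall_integral_mul_conj_eq_zero` — `X` locally compact T2, `μ` finite on compacts and
  positive on nonempty opens, `P : X → ℂ` continuous, `∫ f · conj P dμ = 0` for every continuous compactly
  supported `f : X → ℂ`  ⟹  `P = 0`.  (Proof: test against `f := φ · P` with `φ` an Urysohn bump at `x₀`,
  `exists_tsupport_one_of_isOpen_isClosed`; then `∫ φ‖P‖² = 0` with a continuous nonnegative compactly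
  supported integrand forces `φ(x₀)‖P x₀‖² = 0`, `Continuous.integral_pos_of_hasCompactSupport_nonneg_nonzero`.)
* `eq_zero_of_forall_bump_integral_mul_conj_eq_zero` — the same for test functions from ANY bump-separating class
  `𝒞` of real functions (PerL l. 405 literally takes `f ∈ C_c^∞(U(W)(𝔸))`: smooth at ∞, locally constant at
  the finite places — such a class; supplying its bumps is model work), proved via `Q = Re(conj P(x₀)·P) > 0`
  near `x₀`; corollary `eq_zero_of_forall_integral_real_mul_conj_eq_zero` (real `C_c` test functions suffice).
* `continuous_toricCoeff` — the toric coefficient `h ↦ ∫_T w(t) v(jT(t)·h) dν(t)` of a continuous `v`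
  against a continuous compactly supported weight `w` (pv15's `(β t : ℂ) * conj (χ t)`) is continuous
  (`continuousOn_integral_of_compact_support`) — "the continuous function" of l. 426.
* `toricCoeff_eq_zero_of_forall_test` — the two combined, in exactly the shape of the right-hand side of
  pv15's `unfolding_inner`: `(∀ f ∈ C_c, ∫ f(h) conj(∫ w(t) v(jT t * h) dν) dμ = 0) → ∀ h, ∫ w(t) v(jT t * h) dν = 0`.
* `eq_zero_of_unfolding` — the literal inference of ll. 423–426 over an ABSTRACT pairing `pair f = ⟨E^χ_f, v⟩`
  satisfying an unfolding identity `pair f = ∫ f · conj P dμ` (instantiate `pair`/the identity with pv15's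
  `unfolding_inner` once both files are landed; this file does not import another seat's WIP module).

This discharges, at kernel level and modulo only the model glue, the consequence form of the field
`AnnihilationDatum.unfold` of `HodgeCM/PerL34/Annihilation.lean` (pv06, N23c): there `unfold` reads
"(∀ f, ⟪E χ f, j x⟫ = 0) → ∀ h, P_T(emb χ)(R_c h x) = 0", which is `eq_zero_of_unfolding` with
`P h := P_T(emb χ)(R_c h x)`.
-/
import Mathlib
import Literature.MeasureTheory.Integral.FundamentalLemmaContinuous
import Literature.MeasureTheory.Integral.BumpApproximateIdentity

open MeasureTheory Set

noncomputable section

namespace HodgeCM.PerL34.Vanishing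

/-! ### Urysohn bump at a point of a locally compact Hausdorff space -/

section Bump

variable {X : Type*} [TopologicalSpace X] [LocallyCompactSpace X] [T2Space X]

/-- At every point of a locally compact Hausdorff space there is a continuous compactly supported
function with values in `[0,1]` taking the value `1` at the point. -/
theorem exists_bump (x₀ : X) :
    ∃ φ : X → ℝ, Continuous φ ∧ HasCompactSupport φ ∧ (∀ x, 0 ≤ φ x) ∧ φ x₀ = 1 := by
  obtain ⟨K, hK, hKx⟩ := exists_compact_mem_nhds x₀
  have hx₀ : x₀ ∈ interior K := mem_interior_iff_mem_nhds.mpr hKx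
  have hcl : IsCompact (closure (interior K)) :=
    hK.of_isClosed_subset isClosed_closure (closure_minimal interior_subset hK.isClosed)
  obtain ⟨φ, hφs, hφ1, hφ01⟩ := exists_tsupport_one_of_isOpen_isClosed isOpen_interior hcl
    isClosed_singleton (singleton_subset_iff.mpr hx₀)
  refine ⟨φ, φ.continuous, ?_, fun x => (hφ01 x).1, ?_⟩
  · exact HasCompactSupport.intro hK fun x hx =>
      image_eq_zero_of_notMem_tsupport fun h' => hx (interior_subset (hφs h'))
  · have h1 := hφ1 (mem_singleton x₀)
    simpa using h1

/-- The same with the support inside a prescribed open neighbourhood `U` of the point. -/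
alias exists_bump_subset := Literature.MeasureTheory.Integral.BumpApprox.exists_bump_subset

end Bump

/-! ### The fundamental lemma (complex, sesquilinear form) -/

section FundamentalLemma

variable {X : Type*} [TopologicalSpace X] [LocallyCompactSpace X] [T2Space X]
  [MeasurableSpace X] [BorelSpace X] (μ : Measure X) [IsFiniteMeasureOnCompacts μ] [μ.IsOpenPosMeasure]

/-- **Fundamental lemma of the calculus of variations**, sesquilinear complex form (PerL v5 l. 425–426
"… for all `f`, so the continuous function … vanishes identically"): on a locally compact Hausdorff space
with a measure that is finite on compact sets and charges every nonempty open set (e.g. a Haar measure),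
a continuous `P : X → ℂ` with `∫ f · conj P dμ = 0` for every continuous compactly supported `f` is zero. -/
alias eq_zero_of_forall_integral_mul_conj_eq_zero := Literature.MeasureTheory.Integral.FundamentalLemma.eq_zero_of_forall_integral_mul_conj_eq_zero

omit [LocallyCompactSpace X] in
/-- **Fundamental lemma, test functions from a bump-separating class** (the form PerL needs literally:
l. 405 takes `f ∈ C_c^∞(U(W)(𝔸))`, smooth at the archimedean places and locally constant at the finite
ones — any class `𝒞` of real test functions containing, at every point and inside every open neighbourhood
of it, a continuous compactly supported nonnegative function not vanishing at the point; local
compactness of `X` is then not needed).  If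
`∫ f · conj P dμ = 0` for every `f ∈ 𝒞` and `P` is continuous, then `P = 0`.  Proof: near `x₀` the real
function `Q = Re(conj P(x₀) · P)` exceeds `‖P x₀‖²/2 > 0`; test against a bump `f ∈ 𝒞` supported there:
`∫ f Q dμ = Re (P(x₀) · ∫ f conj P) = 0` with `f Q` continuous, compactly supported, `≥ 0`, `≠ 0` at `x₀`. -/
alias eq_zero_of_forall_bump_integral_mul_conj_eq_zero := Literature.MeasureTheory.Integral.FundamentalLemma.eq_zero_of_forall_bump_integral_mul_conj_eq_zero

/-- Corollary: REAL-valued continuous compactly supported test functions suffice. -/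
alias eq_zero_of_forall_integral_real_mul_conj_eq_zero := Literature.MeasureTheory.Integral.FundamentalLemma.eq_zero_of_forall_integral_real_mul_conj_eq_zero

/-- The same with the pairing written `∫ conj P · f` (either order of the factors). -/
alias eq_zero_of_forall_integral_conj_mul_eq_zero := Literature.MeasureTheory.Integral.FundamentalLemma.eq_zero_of_forall_integral_conj_mul_eq_zero

/-- **PerL v5 ll. 423–426, the inference** over an abstract pairing: if `pair f` (read `⟨E^χ_f, v⟩`)
UNFOLDS as `∫ f · conj P dμ` for every test function `f` (pv15's `unfolding_inner`, with
`P h = P_{T,χ̄}(R(h)v)`), `P` is continuous, and `pair f = 0` for all test `f` (i.e. `v ⟂ 𝓔`), then `P ≡ 0`. -/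
alias eq_zero_of_unfolding := Literature.MeasureTheory.Integral.FundamentalLemma.eq_zero_of_unfolding

end FundamentalLemma

/-! ### The toric coefficient `h ↦ ∫_T w(t) v(jT(t) h) dν(t)` -/

section ToricCoefficient

variable {G : Type*} [Group G] [TopologicalSpace G] [IsTopologicalGroup G]
  {T : Type*} [TopologicalSpace T] [MeasurableSpace T] [OpensMeasurableSpace T]

/-- "the continuous function `h ↦ P_{T,χ̄}(R(h)v)`" (PerL v5 l. 426): for `v : G → ℂ` continuous,
`jT : T → G` continuous and a continuous compactly supported weight `w` on `T` (pv15: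
`w t = β(t) conj χ(t)` with `β` a compactly supported cut-off), the coefficient
`h ↦ ∫ w(t) v(jT(t) h) dν` is continuous (uniformly compactly supported continuous kernel). -/
alias continuous_toricCoeff := Literature.MeasureTheory.Integral.FundamentalLemma.continuous_toricCoeff

variable [LocallyCompactSpace G] [T2Space G] [MeasurableSpace G] [BorelSpace G]

/-- **PerL v5 ll. 423–426 in pv15's typing.**  With `μ` a left Haar measure on `G = U(W)(𝔸)` (any measure
finite on compacts and positive on opens), `ν` on `T = T(𝔸)` finite on compacts, `w = β · conj χ` and `v`
the smooth (continuous) vector: if `∫_G f(h) conj(∫_T w(t) v(jT(t) h) dν) dμ = 0` for every `f ∈ C_c(G)` —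
the right-hand side of pv15's `unfolding_inner` vanishing for all test `f` — then the toric coefficient
`h ↦ ∫_T w(t) v(jT(t) h) dν` vanishes IDENTICALLY. -/
alias toricCoeff_eq_zero_of_forall_test := Literature.MeasureTheory.Integral.FundamentalLemma.toricCoeff_eq_zero_of_forall_test

/-- The same for a Haar measure `μ` (instances `IsHaarMeasure → IsFiniteMeasureOnCompacts`,
`IsHaarMeasure → IsOpenPosMeasure` found by instance resolution; stated for the record). -/
alias toricCoeff_eq_zero_of_forall_test_haar := Literature.MeasureTheory.Integral.FundamentalLemma.toricCoeff_eq_zero_of_forall_test_haar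

end ToricCoefficient

end HodgeCM.PerL34.Vanishing

end
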